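/-
Copyright (c) 2026 the pub-hodgecm-mathlib formalisation cell (harness21).  Prover seat hodgecm-mathlib-LH7-p04 (g3), 2026-09-02 (LH7 leaf ED. 3 road,
print organ O8a `PKsaU2Shape`, step (3): Kneser's argument with the ARCHIMEDEAN places present — a.e. invariance under ONE local group
`SU(F_{v₁})` plus strong approximation «`SU(F) · SU(F_{v₁})` dense in `SU(𝔸)`» gives a.e. invariance under all of `SU(𝔸)`).
-/
import Literature.NumberTheory.Automorphic.AutomorphicQuotientSaturation
import HarnessLib

/-!
# Kneser saturation, normal form: a.e. invariance under a closed normal `M₁` spreads to a closed normal `N` contained in the closure of the group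
# generated by `M₁` and stabilizer elements

Topic `NumberTheory/Automorphic`; THEOREMS ONLY (no definition, no instance, no named fact, no notation, no `sorry`).  Sequel of ★
`AutomorphicQuotientSaturation` (there: `M₀` OPEN in `N` and `N ∩ Stab(x₀)` dense in `N` — the purely finite-adelic form) and of ★
`AutomorphicQuotientSubgroupErgodic` (Moore's lemma).  THIS form is the one the adelic consumer meets: `G = G(𝔸) ∋` archimedean components,
`N = SU(𝔸)` (ALL places), `M₁ = SU(F_{v₁})` at ONE finite place, and strong approximation in Kneser's shape «`SU(F) · SU(F_{v₁})` is dense in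
`SU(𝔸)`» ([PlatonovRapinchuk1994] §7.4 Thm. 7.12; [Kneser1966]); no subgroup open in `N` exists at the archimedean places, so ★
`AutomorphicQuotientSaturation` does not apply verbatim — the density argument of ★ `smul_set_ae_eq_of_dense` (continuity of translation in
`L¹`) replaces the exact decomposition.

THE MATHEMATICS.  `G` locally compact second countable acting continuously and transitively on a Borel space `X`, invariant s-finite `μ`,
`x₀ ∈ X`, `H = Stab(x₀)`; `M₁, N ⊴ G` closed normal subgroups; `D ⊆ H`; hypothesis `N ⊆ closure ⟨D ∪ M₁⟩`.  Let `s ⊆ X` be measurable and a.e.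
invariant under each `m ∈ M₁`.  Pull back to `S ⊆ G` (null sets correspond, ★ `measure_eq_zero_iff_measure_preimage_orbit_eq_zero`); strictify over
the Haar measure of `M₁` (`exists_strictify`): `S' = S` a.e., EXACTLY left-`M₁`-invariant, EXACTLY right-`H`-invariant, hence (normality) exactly
right-`M₁`-invariant; so `T = S'⁻¹` is exactly left-invariant under `H` and `M₁`, hence under the group `⟨H ∪ M₁⟩ ⊇ ⟨D ∪ M₁⟩`, hence
(`smul_set_ae_eq_of_subset_closure`, continuity of translation in `L¹(G)`) a.e. invariant under every element of its CLOSURE `⊇ N`; strictify `T`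
over `N`: `T' = T` a.e., exactly left-`N`-invariant; `T'⁻¹` is exactly right-`N`-, hence (normality) left-`N`-invariant and `T'⁻¹ = S` a.e.; so `S`,
i.e. `s`, is a.e. invariant under every `n ∈ N`.

* §1 `smul_set_ae_eq_of_subset_closure` (relative form of ★ `smul_set_ae_eq_of_dense`); `exists_strictify` (the strict version of an a.e.
  `M`-invariant set, `M` a closed subgroup; extracted from the proof of ★ `ergodicSMul_subgroup_of_dense_mul_stabilizer`).
* §2 **`preimage_smul_ae_eq_of_normal_of_subset_closure`** (sets), **`comp_smul_ae_eq_of_normal_of_subset_closure`** (functions).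
* §3 **`AdelicGroupData.rightRegular_apply_eq_self_of_normal_of_subset_closure`** — in `L²(G(𝔸_K) ⧸ A_G G(K))`: `R(m) f = f` for all `m` in
  a closed normal `M₁` and `N ⊆ closure ⟨D ∪ M₁⟩` with `D ⊆ A_G · G(K)` (`N` closed normal) give `R(n) f = f` for all `n ∈ N`.

CONSUMER (cell `hodgecm-mathlib`, crux H413 = stmt-HodgeConjecture-24833, LH7 ∕ O8a `PKsaU2Shape` steps (3)–(4)): `N = {g ∈ U(Φ₂)(𝔸_{L⁺}) | det g = 1}`,
`M₁ = ι_{v₁}(SU(Φ₂)(L⁺_{v₁}))`, `D = toAdelic '' SU(Φ₂)(L⁺)`; the density hypothesis is the head of the (M1) strong-approximation brick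
(`UnitaryGroupRankTwoStrongApproximation`), the `M₁`-invariance is ★ `DiscreteAutomorphicRepConjStableFixed` + ★ `UnitaryGroupRankTwoLocalCharacterIsotypy`,
and the conclusion «`SU(Φ₂)(𝔸)` acts trivially on `P`» feeds ★ `AutomorphicScalarSubgroup` and ★ `UnitaryGroupDetCharacterSection`.
HONEST LABEL: generic measure theory; HC_CM is proved only modulo the printed citations of that programme until its rung 0 closes.

References: [PlatonovRapinchuk1994] §7.4 (Thm. 7.12, proof of Prop. 7.13); [Kneser1966] M. Kneser, *Strong approximation*, Proc. Sympos. Pure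
Math. IX (1966); [Zimmer1984] R. J. Zimmer, *Ergodic theory and semisimple groups* (1984), App. B.
-/

set_option autoImplicit false

noncomputable section

open MeasureTheory Filter Set Topology
open scoped ENNReal Pointwise

namespace Literature.NumberTheory.Automorphic

/-! ## §1 Relative density; strictification of an a.e. invariant set over a closed subgroup -/

section Group

variable {G : Type*} [Group G] [TopologicalSpace G] [IsTopologicalGroup G] [SecondCountableTopology G] [LocallyCompactSpace G]

/-- **Exact invariance under a set `D` of left translations gives a.e. invariance under every element of `closure D`** (left Haar measure `ν`
on a locally compact second countable group; for a measurable `C` of finite measure `g ↦ ν (g • T ∩ C)` is continuous — continuity of translation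
in `L¹(G, ν)`, Mathlib `Lp.instContinuousSMulDomMulAct` — and equal to `ν (T ∩ C)` on `D`, hence on `closure D`).  The relative form of ★
`smul_set_ae_eq_of_dense`. [cite: Zimmer1984, App. B Prop. B.5] -/
theorem smul_set_ae_eq_of_subset_closure [MeasurableSpace G] [BorelSpace G] (ν : Measure G) [ν.IsHaarMeasure]
    [ν.InnerRegularCompactLTTop] {T : Set G} (hT : MeasurableSet T) {D : Set G}
    (hinv : ∀ d ∈ D, d • T = T) {g : G} (hg : g ∈ closure D) : g • T =ᵐ[ν] T := by
  haveI : Fact ((1 : ℝ≥0∞) ≤ 1) := ⟨le_rfl⟩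
  haveI : Fact ((1 : ℝ≥0∞) ≠ ∞) := ⟨ENNReal.one_ne_top⟩
  -- (1) for every measurable `C` of finite measure, `ν (g • T ∩ C) = ν (T ∩ C)`
  have key : ∀ C : Set G, MeasurableSet C → ν C ≠ ∞ → ν (g • T ∩ C) = ν (T ∩ C) := by
    intro C hC hCfin
    set F : Lp ℝ 1 ν := indicatorConstLp 1 hC hCfin (1 : ℝ) with hF
    set Ψ : G → ℝ := fun g => ∫ x in T, ((DomMulAct.mk g • F : Lp ℝ 1 ν) : G → ℝ) x ∂ν with hΨ
    have hΨc : Continuous Ψ :=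
      (continuous_setIntegral T).comp ((DomMulAct.continuous_mk.comp continuous_id).smul continuous_const)
    have hΨv : ∀ g : G, Ψ g = ν.real (g • T ∩ C) := by
      intro g
      have h1 : ((DomMulAct.mk g • F : Lp ℝ 1 ν) : G → ℝ) =ᵐ[ν] fun x => (g⁻¹ • C).indicator (fun _ => (1 : ℝ)) x := by
        have hF' : (F : G → ℝ) =ᵐ[ν] C.indicator fun _ => (1 : ℝ) := indicatorConstLp_coeFn
        have h2 : ((DomMulAct.mk g • F : Lp ℝ 1 ν) : G → ℝ) =ᵐ[ν] fun x => (F : G → ℝ) (g • x) := by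
          simpa only [DomMulAct.mk.symm_apply_apply] using DomMulAct.smul_Lp_ae_eq (DomMulAct.mk g) F
        have h3 : (fun x => (F : G → ℝ) (g • x)) =ᵐ[ν] fun x => (C.indicator fun _ => (1 : ℝ)) (g • x) :=
          (MeasurePreserving.quasiMeasurePreserving (measurePreserving_smul g ν)).ae_eq_comp hF'
        have h4 : (fun x => (C.indicator fun _ => (1 : ℝ)) (g • x)) = fun x => (g⁻¹ • C).indicator (fun _ => (1 : ℝ)) x := by
          funext x
          by_cases hx : g • x ∈ C
          · have hx' : x ∈ g⁻¹ • C := by rwa [mem_smul_set_iff_inv_smul_mem, inv_inv]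
            rw [Set.indicator_of_mem hx, Set.indicator_of_mem hx']
          · have hx' : x ∉ g⁻¹ • C := by rwa [mem_smul_set_iff_inv_smul_mem, inv_inv]
            rw [Set.indicator_of_notMem hx, Set.indicator_of_notMem hx']
        rw [h4] at h3
        exact h2.trans h3
      calc Ψ g = ∫ x in T, (g⁻¹ • C).indicator (fun _ => (1 : ℝ)) x ∂ν :=
            setIntegral_congr_ae hT (h1.mono fun x hx _ => hx)
        _ = ∫ x in T ∩ g⁻¹ • C, (1 : ℝ) ∂ν := setIntegral_indicator (hC.const_smul g⁻¹)
        _ = ν.real (T ∩ g⁻¹ • C) := by rw [setIntegral_const, smul_eq_mul, mul_one]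
        _ = ν.real (g • T ∩ C) := by
            rw [show T ∩ g⁻¹ • C = g⁻¹ • (g • T ∩ C) by rw [smul_set_inter, inv_smul_smul],
              measureReal_def, measureReal_def, measure_smul]
    -- `Ψ` equals `Ψ 1` on `D`, hence on `closure D`
    have hΨD : Ψ g = Ψ 1 := by
      have hsub : D ⊆ {x | Ψ x = Ψ 1} := fun d hd => by
        simp only [mem_setOf_eq, hΨv, hinv d hd, one_smul]
      have hcl : IsClosed {x | Ψ x = Ψ 1} := isClosed_eq hΨc continuous_const
      exact (hcl.closure_subset_iff.2 hsub) hg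
    rw [hΨv, hΨv, one_smul, measureReal_def, measureReal_def] at hΨD
    exact (ENNReal.toReal_eq_toReal_iff' (measure_ne_top_of_subset inter_subset_right hCfin)
      (measure_ne_top_of_subset inter_subset_right hCfin)).1 hΨD
  -- (2) exhaust `G` by measurable sets of finite measure
  have hgT : MeasurableSet (g • T) := hT.const_smul g
  rw [ae_eq_set]
  constructor
  · have h : ∀ n : ℕ, ν ((g • T \ T) ∩ spanningSets ν n) = 0 := by
      intro n
      have hC : MeasurableSet (spanningSets ν n \ T) := (measurableSet_spanningSets ν n).diff hT
      have hCfin : ν (spanningSets ν n \ T) ≠ ∞ :=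
        measure_ne_top_of_subset sdiff_subset (measure_spanningSets_lt_top ν n).ne
      have h1 := key _ hC hCfin
      rw [show T ∩ (spanningSets ν n \ T) = ∅ by
        ext x; simp only [mem_inter_iff, Set.mem_sdiff, mem_empty_iff_false]; tauto, measure_empty] at h1
      rw [show (g • T \ T) ∩ spanningSets ν n = g • T ∩ (spanningSets ν n \ T) by
        ext x; simp only [mem_inter_iff, Set.mem_sdiff]; tauto]
      exact h1
    rw [show g • T \ T = ⋃ n, (g • T \ T) ∩ spanningSets ν n by rw [← inter_iUnion, iUnion_spanningSets, inter_univ]]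
    exact measure_iUnion_null h
  · have h : ∀ n : ℕ, ν ((T \ g • T) ∩ spanningSets ν n) = 0 := by
      intro n
      have hC : MeasurableSet (spanningSets ν n ∩ T) := (measurableSet_spanningSets ν n).inter hT
      have hCfin : ν (spanningSets ν n ∩ T) ≠ ∞ :=
        measure_ne_top_of_subset inter_subset_left (measure_spanningSets_lt_top ν n).ne
      have h1 := key _ hC hCfin
      rw [show T ∩ (spanningSets ν n ∩ T) = spanningSets ν n ∩ T by
        ext x; simp only [mem_inter_iff]; tauto] at h1
      have h2 := measure_inter_add_sdiff (μ := ν) (spanningSets ν n ∩ T) hgT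
      rw [show spanningSets ν n ∩ T ∩ g • T = g • T ∩ (spanningSets ν n ∩ T) by
        ext x; simp only [mem_inter_iff]; tauto, h1] at h2
      have h3 : ν ((spanningSets ν n ∩ T) \ g • T) = 0 :=
        (ENNReal.add_right_inj hCfin).1 (h2.trans (add_zero _).symm)
      rw [show (T \ g • T) ∩ spanningSets ν n = (spanningSets ν n ∩ T) \ g • T by
        ext x; simp only [mem_inter_iff, Set.mem_sdiff]; tauto]
      exact h3
    rw [show T \ g • T = ⋃ n, (T \ g • T) ∩ spanningSets ν n by rw [← inter_iUnion, iUnion_spanningSets, inter_univ]]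
    exact measure_iUnion_null h

/-- **Strictification over a closed subgroup.**  Let `M ≤ G` be a closed subgroup of a locally compact second countable group, `ν` an s-finite
measure on `G` and `S ⊆ G` measurable with `m S = S` `ν`-a.e. for every `m ∈ M` (in the form «for `ν`-a.e. `g`, `m g ∈ S ↔ g ∈ S`»).  Then
`S' = {g | m g ∈ S for ν_M-a.e. m ∈ M}` (`ν_M` a Haar measure of `M`) is measurable, equal to `S` a.e. (Fubini), EXACTLY invariant under left
translation by `M`, and inherits every exact right invariance of `S`. [cite: Zimmer1984, App. B Prop. B.5] -/
theorem exists_strictify [MeasurableSpace G] [BorelSpace G] (ν : Measure G) [SFinite ν] (M : Subgroup G) (hM : IsClosed (M : Set G))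
    {S : Set G} (hS : MeasurableSet S) (hinv : ∀ m ∈ M, ∀ᵐ g ∂ν, (m * g ∈ S ↔ g ∈ S)) :
    ∃ S' : Set G, MeasurableSet S' ∧ S' =ᵐ[ν] S ∧ (∀ m ∈ M, ∀ g : G, m * g ∈ S' ↔ g ∈ S') ∧
      ∀ h : G, (∀ g : G, g * h ∈ S ↔ g ∈ S) → ∀ g : G, g * h ∈ S' ↔ g ∈ S' := by
  haveI : SecondCountableTopology M := TopologicalSpace.Subtype.secondCountableTopology (M : Set G)
  haveI : LocallyCompactSpace M := hM.locallyCompactSpace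
  set νM : Measure M := Measure.haar with hνM
  have hνM0 : νM (univ : Set M) ≠ 0 := isOpen_univ.measure_ne_zero νM ⟨1, trivial⟩
  set S' : Set G := {g | ∀ᵐ (m : M) ∂νM, (m : G) * g ∈ S} with hS'def
  have hmul : Measurable fun p : M × G => (p.1 : G) * p.2 :=
    ((continuous_subtype_val.comp continuous_fst).mul continuous_snd).measurable
  have hE : MeasurableSet {p : M × G | (p.1 : G) * p.2 ∈ S} := hmul hS
  have hS'm : MeasurableSet S' := by
    have h := measurable_measure_prodMk_right (μ := νM) hE.compl
    have hS'eq : S' = (fun g : G => νM ((fun m : M => (m, g)) ⁻¹' {p : M × G | (p.1 : G) * p.2 ∈ S}ᶜ)) ⁻¹' {0} := by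
      ext g
      simp only [hS'def, mem_setOf_eq, mem_preimage, mem_singleton_iff]
      rw [ae_iff]
      rfl
    rw [hS'eq]
    exact h (measurableSet_singleton 0)
  refine ⟨S', hS'm, ?_, ?_, ?_⟩
  · have h2 : ∀ᵐ (m : M) ∂νM, ∀ᵐ g ∂ν, ((m : G) * g ∈ S ↔ g ∈ S) := ae_of_all _ fun m => hinv m m.2
    have hmeas : MeasurableSet {p : M × G | ((p.1 : G) * p.2 ∈ S ↔ p.2 ∈ S)} := by
      have heq : {p : M × G | ((p.1 : G) * p.2 ∈ S ↔ p.2 ∈ S)} =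
          ({p : M × G | (p.1 : G) * p.2 ∈ S} ∩ {p | p.2 ∈ S}) ∪ ({p : M × G | (p.1 : G) * p.2 ∈ S}ᶜ ∩ {p | p.2 ∈ S}ᶜ) := by
        ext p
        simp only [mem_setOf_eq, mem_union, mem_inter_iff, mem_compl_iff]
        tauto
      rw [heq]
      exact (hE.inter (measurable_snd hS)).union (hE.compl.inter (measurable_snd hS).compl)
    have h3 : ∀ᵐ g ∂ν, ∀ᵐ (m : M) ∂νM, ((m : G) * g ∈ S ↔ g ∈ S) := (Measure.ae_ae_comm hmeas).1 h2
    refine eventuallyEq_set.2 ?_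
    filter_upwards [h3] with g hg
    constructor
    · intro hg'
      by_contra hgS
      have hfalse : ∀ᵐ (_m : M) ∂νM, False := by
        filter_upwards [hg', hg] with m hm1 hm2
        exact hgS (hm2.1 hm1)
      have h0 := ae_iff.1 hfalse
      simp only [not_false_eq_true, setOf_true] at h0
      exact hνM0 h0
    · exact fun hgS => hg.mono fun m hm => hm.2 hgS
  · intro m₀ hm₀ g
    simp only [hS'def, mem_setOf_eq]
    have h1 : (∀ᵐ (m : M) ∂νM, (m : G) * (m₀ * g) ∈ S) ↔ ∀ᵐ (m : M) ∂νM, ((m * ⟨m₀, hm₀⟩ : M) : G) * g ∈ S := by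
      simp only [Subgroup.coe_mul, mul_assoc]
    rw [h1, ae_iff, ae_iff]
    exact measure_mul_right_null (s := {a : M | ¬ ((a : G) * g ∈ S)}) νM ⟨m₀, hm₀⟩
  · intro h hh g
    simp only [hS'def, mem_setOf_eq, ← mul_assoc, hh]

end Group

/-! ## §2 Kneser saturation, normal form -/

section Abstract

variable {G X : Type*} [Group G] [TopologicalSpace G] [IsTopologicalGroup G]
  [SecondCountableTopology G] [LocallyCompactSpace G] [MulAction G X] [TopologicalSpace X] [MeasurableSpace X]
  [BorelSpace X] [ContinuousSMul G X] [MulAction.IsPretransitive G X]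

/-- **Kneser saturation, normal form (sets).**  Let a locally compact second countable group `G` act continuously and transitively on a Borel space
`X` with an invariant s-finite measure `μ`; let `M₁, N ⊴ G` be CLOSED NORMAL subgroups and `D ⊆ Stab(x₀)` with `N ⊆ closure ⟨D ∪ M₁⟩`.  If a
measurable `s ⊆ X` satisfies `m⁻¹ s = s` a.e. for every `m ∈ M₁`, then `n⁻¹ s = s` a.e. for every `n ∈ N`.  (No subgroup open in `N` is needed;
this is the form with archimedean components — `N = SU(𝔸)`, `M₁ = SU(F_{v₁})`, density = strong approximation.)
[cite: PlatonovRapinchuk1994, §7.4 Prop. 7.13 (proof)] [cite: Zimmer1984, App. B] -/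
theorem preimage_smul_ae_eq_of_normal_of_subset_closure (μ : Measure X) [SFinite μ] [SMulInvariantMeasure G X μ]
    (N M₁ : Subgroup G) [N.Normal] [M₁.Normal] (hN : IsClosed (N : Set G)) (hM₁ : IsClosed (M₁ : Set G)) (x₀ : X)
    {D : Set G} (hD : D ⊆ (MulAction.stabilizer G x₀ : Set G))
    (hdense : (N : Set G) ⊆ closure ((Subgroup.closure (D ∪ (M₁ : Set G)) : Subgroup G) : Set G))
    {s : Set X} (hs : MeasurableSet s) (hinv : ∀ m ∈ M₁, (fun x => m • x) ⁻¹' s =ᵐ[μ] s)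
    {n : G} (hn : n ∈ N) : (fun x => n • x) ⁻¹' s =ᵐ[μ] s := by
  borelize G
  rcases eq_zero_or_neZero μ with rfl | hμ
  · rw [ae_zero]; exact eventually_bot
  set ν : Measure G := Measure.haar with hν
  set Θ : G → X := fun g => g • x₀ with hΘ
  have hΘm : Measurable Θ := (continuous_id.smul continuous_const).measurable
  have key : ∀ A : Set X, MeasurableSet A → (μ A = 0 ↔ ν (Θ ⁻¹' A) = 0) := fun A hA =>
    measure_eq_zero_iff_measure_preimage_orbit_eq_zero μ ν x₀ hA
  set S : Set G := Θ ⁻¹' s with hSdef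
  have hS : MeasurableSet S := hΘm hs
  -- transport of a.e. invariance between `s` and `S`
  have hpre : ∀ g : G, (g • ·) ⁻¹' S = Θ ⁻¹' ((g • ·) ⁻¹' s) := fun g => by
    ext k; simp only [mem_preimage, hSdef, hΘ, smul_eq_mul, mul_smul]
  have htoG : ∀ g : G, (g • ·) ⁻¹' s =ᵐ[μ] s → ∀ᵐ k ∂ν, (g * k ∈ S ↔ k ∈ S) := by
    intro g h2
    have hgs : MeasurableSet ((g • ·) ⁻¹' s) := measurableSet_preimage (measurable_const_smul g) hs
    rw [ae_eq_set] at h2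
    have e1 : ν ((g • ·) ⁻¹' S \ S) = 0 := by
      rw [hpre, hSdef, ← preimage_sdiff]; exact (key _ (hgs.diff hs)).1 h2.1
    have e2 : ν (S \ (g • ·) ⁻¹' S) = 0 := by
      rw [hpre, hSdef, ← preimage_sdiff]; exact (key _ (hs.diff hgs)).1 h2.2
    exact eventuallyEq_set.1 (ae_eq_set.2 ⟨e1, e2⟩)
  have htoX : ∀ g : G, (g • ·) ⁻¹' S =ᵐ[ν] S → (g • ·) ⁻¹' s =ᵐ[μ] s := by
    intro g h2
    have hgs : MeasurableSet ((g • ·) ⁻¹' s) := measurableSet_preimage (measurable_const_smul g) hs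
    rw [ae_eq_set] at h2 ⊢
    refine ⟨(key _ (hgs.diff hs)).2 ?_, (key _ (hs.diff hgs)).2 ?_⟩
    · rw [preimage_sdiff, ← hpre]; exact h2.1
    · rw [preimage_sdiff, ← hpre]; exact h2.2
  have hSH : ∀ h ∈ MulAction.stabilizer G x₀, ∀ g : G, g * h ∈ S ↔ g ∈ S := by
    intro h hh g
    simp only [hSdef, mem_preimage, hΘ, mul_smul, MulAction.mem_stabilizer_iff.1 hh]
  -- (1) strictify over `M₁`
  obtain ⟨S', hS'm, hS'S, hS'M, hS'H⟩ :=
    exists_strictify ν M₁ hM₁ hS fun m hm => htoG m (hinv m hm)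
  have hS'Mr : ∀ m₀ ∈ M₁, ∀ g : G, g * m₀ ∈ S' ↔ g ∈ S' := by
    intro m₀ hm₀ g
    have hc : g * m₀ * g⁻¹ ∈ M₁ := Subgroup.Normal.conj_mem inferInstance m₀ hm₀ g
    have h1 := hS'M _ hc g
    rwa [inv_mul_cancel_right] at h1
  -- (2) `T = S'⁻¹` is exactly invariant under the subgroup generated by `Stab(x₀)` and `M₁`
  set T : Set G := S'⁻¹ with hTdef
  have hT : MeasurableSet T := hS'm.inv
  have hfix : ∀ d ∈ ((Subgroup.closure (D ∪ (M₁ : Set G)) : Subgroup G) : Set G), d • T = T := by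
    -- the exact stabiliser of `T` as a subgroup
    let Fix : Subgroup G :=
      { carrier := {d | d • T = T}
        one_mem' := one_smul G T
        mul_mem' := fun {a b} ha hb => by simp only [mem_setOf_eq] at ha hb ⊢; rw [mul_smul, hb, ha]
        inv_mem' := fun {a} ha => by
          simp only [mem_setOf_eq] at ha ⊢
          conv_lhs => rw [← ha]
          rw [inv_smul_smul] }
    have hle : Subgroup.closure (D ∪ (M₁ : Set G)) ≤ Fix := by
      rw [Subgroup.closure_le]
      rintro d (hd | hd)
      · show d • T = T
        ext t
        rw [mem_smul_set_iff_inv_smul_mem, smul_eq_mul, hTdef, Set.mem_inv, Set.mem_inv, mul_inv_rev, inv_inv,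
          hS'H d (hSH d (hD hd))]
      · show d • T = T
        ext t
        rw [mem_smul_set_iff_inv_smul_mem, smul_eq_mul, hTdef, Set.mem_inv, Set.mem_inv, mul_inv_rev, inv_inv,
          hS'Mr d hd]
    intro d hd
    exact hle hd
  -- (3) a.e. invariance of `T` under every element of `N`
  have hTae : ∀ n' ∈ N, n' • T =ᵐ[ν] T := fun n' hn' =>
    smul_set_ae_eq_of_subset_closure ν hT hfix (hdense hn')
  -- (4) strictify `T` over `N`
  have hTinv : ∀ n' ∈ N, ∀ᵐ k ∂ν, (n' * k ∈ T ↔ k ∈ T) := by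
    intro n' hn'
    have h1 : (n' • ·) ⁻¹' T = n'⁻¹ • T := by
      ext k; rw [mem_preimage, mem_smul_set_iff_inv_smul_mem, inv_inv]
    have h2 : (n' • ·) ⁻¹' T =ᵐ[ν] T := by rw [h1]; exact hTae n'⁻¹ (N.inv_mem hn')
    exact eventuallyEq_set.1 h2
  obtain ⟨T', hT'm, hT'T, hT'N, -⟩ := exists_strictify ν N hN hT hTinv
  -- (5) `T'⁻¹` is exactly left `N`-invariant (normality) and a.e. equal to `S`
  set S'' : Set G := T'⁻¹ with hS''def
  have hS''N : ∀ n' ∈ N, ∀ g : G, n' * g ∈ S'' ↔ g ∈ S'' := by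
    intro n' hn' g
    have hc : g⁻¹ * n'⁻¹ * g ∈ N := by
      have := Subgroup.Normal.conj_mem inferInstance n'⁻¹ (N.inv_mem hn') g⁻¹
      simpa only [inv_inv, mul_assoc] using this
    rw [hS''def, Set.mem_inv, Set.mem_inv, mul_inv_rev, show g⁻¹ * n'⁻¹ = (g⁻¹ * n'⁻¹ * g) * g⁻¹ by group, hT'N _ hc]
  have hS''S : S'' =ᵐ[ν] S := by
    have h1 : (T'⁻¹ : Set G) =ᵐ[ν] (T⁻¹ : Set G) := by
      have h0 := (quasiMeasurePreserving_inv ν).preimage_ae_eq hT'T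
      simpa only [Set.inv_preimage] using h0
    rw [hTdef, inv_inv] at h1
    exact h1.trans hS'S
  -- (6) conclusion
  have h1 : (n • ·) ⁻¹' S'' = S'' := by
    ext k; simp only [mem_preimage, smul_eq_mul, hS''N n hn]
  have h2 : (n • ·) ⁻¹' S =ᵐ[ν] S := by
    have h3 : (n • ·) ⁻¹' S =ᵐ[ν] (n • ·) ⁻¹' S'' :=
      ((measurePreserving_mul_left ν n).quasiMeasurePreserving).preimage_ae_eq hS''S.symm
    rw [h1] at h3
    exact h3.trans hS''S
  exact htoX n h2

/-- **Kneser saturation, normal form (functions).**  Same setting; a measurable `f : X → E` into a second countable metrizable space with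
`f (m • x) = f x` a.e. for every `m ∈ M₁` satisfies `f (n • x) = f x` a.e. for every `n ∈ N`. [cite: PlatonovRapinchuk1994, §7.4 Prop. 7.13 (proof)] -/
theorem comp_smul_ae_eq_of_normal_of_subset_closure {E : Type*} [TopologicalSpace E] [TopologicalSpace.MetrizableSpace E]
    [SecondCountableTopology E] [MeasurableSpace E] [BorelSpace E]
    (μ : Measure X) [SFinite μ] [SMulInvariantMeasure G X μ]
    (N M₁ : Subgroup G) [N.Normal] [M₁.Normal] (hN : IsClosed (N : Set G)) (hM₁ : IsClosed (M₁ : Set G)) (x₀ : X)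
    {D : Set G} (hD : D ⊆ (MulAction.stabilizer G x₀ : Set G))
    (hdense : (N : Set G) ⊆ closure ((Subgroup.closure (D ∪ (M₁ : Set G)) : Subgroup G) : Set G))
    {f : X → E} (hfm : Measurable f) (hinv : ∀ m ∈ M₁, (fun x => f (m • x)) =ᵐ[μ] f)
    {n : G} (hn : n ∈ N) : (fun x => f (n • x)) =ᵐ[μ] f := by
  letI := TopologicalSpace.metrizableSpaceMetric E
  obtain ⟨b, hbc, -, hb⟩ := TopologicalSpace.exists_countable_basis E
  have hset : ∀ V ∈ b, (fun x => n • x) ⁻¹' (f ⁻¹' V) =ᵐ[μ] f ⁻¹' V := by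
    intro V hV
    have hVm : MeasurableSet (f ⁻¹' V) := hfm (hb.isOpen hV).measurableSet
    exact preimage_smul_ae_eq_of_normal_of_subset_closure μ N M₁ hN hM₁ x₀ hD hdense hVm
      (fun m hm => (hinv m hm).preimage V) hn
  have hnull : ∀ V : b, μ (((fun x => n • x) ⁻¹' (f ⁻¹' (V : Set E))) \ (f ⁻¹' V) ∪
      ((f ⁻¹' (V : Set E)) \ ((fun x => n • x) ⁻¹' (f ⁻¹' V)))) = 0 := by
    intro V
    have h := hset V V.2
    rw [ae_eq_set] at h
    exact measure_union_null h.1 h.2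
  haveI : Countable b := hbc.to_subtype
  rw [Filter.EventuallyEq, ae_iff]
  refine measure_mono_null (fun x hx => ?_) (measure_iUnion_null hnull)
  simp only [mem_setOf_eq] at hx
  obtain ⟨V, hVb, hV1, hV2⟩ := hb.exists_subset_of_mem_open (by exact hx : f (n • x) ∈ ({f x}ᶜ : Set E))
    isOpen_compl_singleton
  exact mem_iUnion.2 ⟨⟨V, hVb⟩, Or.inl ⟨hV1, fun hxV => hV2 hxV rfl⟩⟩

end Abstract

/-! ## §3 The automorphic quotient -/

namespace AdelicGroupData

universe u

variable {K : Type} [Field K] [NumberField K] (𝒢 : AdelicGroupData.{u} K)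
  [LocallyCompactSpace 𝒢.Adelic] [SecondCountableTopology 𝒢.Adelic]
  (μ : Measure 𝒢.automorphicQuotient) [𝒢.IsAutomorphicMeasure μ]

/-- **Kneser saturation in `L²(G(𝔸_K) ⧸ A_G G(K))`, normal form.**  Let `M₁, N ≤ G(𝔸_K)` be CLOSED NORMAL subgroups and `D ⊆ A_G · G(K)` a set
with `N ⊆ closure ⟨D ∪ M₁⟩` (for `N = SU(𝔸)`, `M₁ = SU(F_{v₁})`, `D = SU(F)` this is strong approximation «`SU(F) SU(F_{v₁})` dense in
`SU(𝔸)`»).  If `f ∈ L²` is fixed by `R(m)` for every `m ∈ M₁`, then `f` is fixed by `R(n)` for every `n ∈ N`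
(`comp_smul_ae_eq_of_normal_of_subset_closure` on the automorphic quotient, stabilizer `A_G · G(K)` by Mathlib `MulAction.stabilizer_quotient`,
a.e. formula ★ `rightRegular_apply_coeFn`). [cite: PlatonovRapinchuk1994, §7.4 Thm. 7.12 and Prop. 7.13 (proof)] [cite: Kneser1966, Hauptsatz] -/
theorem rightRegular_apply_eq_self_of_normal_of_subset_closure (N M₁ : Subgroup 𝒢.Adelic) [N.Normal] [M₁.Normal]
    (hN : IsClosed (N : Set 𝒢.Adelic)) (hM₁ : IsClosed (M₁ : Set 𝒢.Adelic)) {D : Set 𝒢.Adelic}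
    (hD : D ⊆ (𝒢.quotientSubgroup : Set 𝒢.Adelic))
    (hdense : (N : Set 𝒢.Adelic) ⊆ closure ((Subgroup.closure (D ∪ (M₁ : Set 𝒢.Adelic)) : Subgroup 𝒢.Adelic) : Set 𝒢.Adelic))
    {f : 𝒢.L2 μ} (hf : ∀ m ∈ M₁, 𝒢.rightRegular μ m f = f) {n : 𝒢.Adelic} (hn : n ∈ N) :
    𝒢.rightRegular μ n f = f := by
  haveI : MulAction.IsPretransitive 𝒢.Adelic 𝒢.automorphicQuotient :=
    inferInstanceAs (MulAction.IsPretransitive 𝒢.Adelic (𝒢.Adelic ⧸ 𝒢.quotientSubgroup))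
  have hstab : MulAction.stabilizer 𝒢.Adelic (𝒢.toAutomorphicQuotient 1) = 𝒢.quotientSubgroup :=
    MulAction.stabilizer_quotient 𝒢.quotientSubgroup
  have hD' : D ⊆ (MulAction.stabilizer 𝒢.Adelic (𝒢.toAutomorphicQuotient 1) : Set 𝒢.Adelic) := by
    rw [hstab]; exact hD
  have hinv : ∀ m ∈ M₁, (fun x => (f : 𝒢.automorphicQuotient → ℂ) (m • x)) =ᵐ[μ] (f : 𝒢.automorphicQuotient → ℂ) := by
    intro m hm
    have h := 𝒢.rightRegular_apply_coeFn μ m⁻¹ f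
    rw [hf _ (M₁.inv_mem hm), inv_inv] at h
    exact h.symm
  have hae : (fun x => (f : 𝒢.automorphicQuotient → ℂ) (n⁻¹ • x)) =ᵐ[μ] (f : 𝒢.automorphicQuotient → ℂ) :=
    comp_smul_ae_eq_of_normal_of_subset_closure μ N M₁ hN hM₁ (𝒢.toAutomorphicQuotient 1) hD' hdense
      (Lp.stronglyMeasurable f).measurable hinv (N.inv_mem hn)
  refine Lp.ext_iff.2 ?_
  exact (𝒢.rightRegular_apply_coeFn μ n f).trans hae

end AdelicGroupData

end Literature.NumberTheory.Automorphic
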